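import Literature.Computability.Cryptography.IndependentTrials
import Literature.Computability.Cryptography.CoinChunks
import Literature.Computability.Cryptography.LWEAmplifyQuery
import HarnessLib

/-!
# The average-case-to-worst-case bridge for search-LWE, IV: the probability estimates

Topic `Computability/Cryptography` (LWE), grouping namespace `LWE.AmpBricks`. The finite-probability
lemmas of the discharge of hypothesis `h₁` of
`Literature.Computability.Cryptography.regev_lwe_to_sivp_quantum_of_worstCase` (Regev 2009, §2
p. 12 and proof of Lemma 4.1; amplification by majority, Arora–Barak 2009 §7.4.1), on top of
`IndependentTrials.lean` (`indepLaw`, Markov, `badCount`), `CoinChunks.lean` (near-uniform residues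
off a coin string, `sum_chunkVal_div_le`) and `LWEAmplifyQuery.lean` (`shiftOfCoins`, `batchOf`,
`queryOf`):

* `indepLaw_toOuterMeasure_half_le_finset` — majority amplification on a SUB-POPULATION `T` of the
  coordinates: `Pr[|T| ≤ 2 #{j ∈ T | bad j}] ≤ ∏_{j ∈ T} (1 + fⱼ) / (√2)^{|T|}`;
* `sum_qreg_take_eq` — averaging a function of the first `L` coins over `L + r` coins is averaging it
  over `L` coins; `chunk_take`, `shiftOfCoins_take` — the shift reads only the first `n · Kw` coins;
* `avg_shiftOfCoins_le` — **the shift is near-uniform** (one-sided, the direction a success bound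
  needs): for a `[0,1]`-valued `F`, `2^{-nKw} Σ_{c ∈ {0,1}^{nKw}} F (shiftOfCoins n q c) ≤
  q^{-n} Σ_t F t + n q / 2^{Kw}`, and `n q / 2^{Kw n q} ≤ n / 2ⁿ`;
* `searchSuccessProbOf_shift` — **Regev's random self-reduction in the secret**: the success
  probability of ANY solver run on the samples shifted by `t` and judged against `s + t` is its success
  probability against the secret `s + t` on fresh samples (`lweSamples_map_shift`), and
  `avg_searchSuccessProbOf_add` — averaged over a uniform `t` this is the AVERAGE-case success
  probability `searchSuccessProb`.

## References

* O. Regev, *On lattices, learning with errors, random linear codes, and cryptography*, J. ACM 56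
  (2009), art. 34, §2 (p. 12), §4 proof of Lemma 4.1 (held: arXiv:2401.03703, p. 23). [cite: Regev2009, §4 Lemma 4.1 (proof)]
* S. Arora, B. Barak, *Computational Complexity: A Modern Approach*, CUP 2009, §7.4.1, §A.2. [cite: AroraBarak2009, §7.4.1]
* M. Naor, O. Reingold, J. ACM 51 (2004), Construction 4.1. [cite: NaorReingold2004, Construction 4.1]
-/

noncomputable section

open scoped ENNReal

namespace Literature.Computability.Cryptography

namespace LWE

open _root_.Computability Literature.Probability.Distributions

/-! ### Majority amplification on a sub-population of the coordinates -/

section Finset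

variable {α : Type} {K : ℕ}

/-- The number of bad coordinates among `T`. [folklore] -/
def badCountOn (T : Finset (Fin K)) (D : Fin K → Set α) [∀ j, DecidablePred (· ∈ D j)] (v : Fin K → α) : ℕ :=
  (T.filter fun j => v j ∈ D j).card

/-- `2^{#bad on T}` as a product over all coordinates (factor `1` off `T`). [folklore] -/
theorem two_pow_badCountOn (T : Finset (Fin K)) (D : Fin K → Set α) [∀ j, DecidablePred (· ∈ D j)] (v : Fin K → α) :
    (2 : ℝ≥0∞) ^ badCountOn T D v = ∏ j, (if j ∈ T then (if v j ∈ D j then (2 : ℝ≥0∞) else 1) else 1) := by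
  classical
  rw [← Finset.prod_filter, Finset.filter_mem_eq_inter, Finset.univ_inter, Finset.prod_ite, Finset.prod_const,
    Finset.prod_const_one, mul_one]
  rfl

/-- **Majority amplification on a sub-population**: if coordinate `j ∈ T` is bad with probability
`≤ fⱼ`, at least half of the coordinates of `T` are bad with probability `≤ ∏_{j∈T} (1 + fⱼ) / (√2)^{|T|}`.
[cite: AroraBarak2009, §7.4.1 (proof of Thm 7.10: error reduction by majority)] -/
theorem indepLaw_toOuterMeasure_half_le_finset (p : Fin K → PMF α) (T : Finset (Fin K)) (D : Fin K → Set α)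
    [∀ j, DecidablePred (· ∈ D j)] (f : Fin K → ℝ≥0∞) (hf : ∀ j ∈ T, (p j).toOuterMeasure (D j) ≤ f j) :
    (indepLaw K p).toOuterMeasure {v | T.card ≤ 2 * badCountOn T D v} ≤
      (∏ j ∈ T, (1 + f j)) / ((NNReal.sqrt 2 : NNReal) : ℝ≥0∞) ^ T.card := by
  classical
  set s : ℝ≥0∞ := ((NNReal.sqrt 2 : NNReal) : ℝ≥0∞) with hs
  have hs1 : 1 ≤ s := by
    rw [hs, ← ENNReal.coe_one, ENNReal.coe_le_coe]
    exact NNReal.one_le_sqrt.2 one_le_two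
  have hs0 : s ^ T.card ≠ 0 := pow_ne_zero _ (ne_of_gt (lt_of_lt_of_le zero_lt_one hs1))
  have hsT : s ^ T.card ≠ ⊤ := ENNReal.pow_ne_top ENNReal.coe_ne_top
  have hsub : {v : Fin K → α | T.card ≤ 2 * badCountOn T D v} ⊆ {v | s ^ T.card ≤ (2 : ℝ≥0∞) ^ badCountOn T D v} := by
    intro v hv
    have h1 : s ^ T.card ≤ s ^ (2 * badCountOn T D v) := pow_le_pow_right' hs1 hv
    rw [hs, sqrt_two_pow_two_mul] at h1
    exact h1
  refine ((indepLaw K p).toOuterMeasure.mono hsub).trans ?_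
  refine (PMF.toOuterMeasure_setOf_le_div _ _ hs0 hsT).trans ?_
  gcongr
  simp_rw [two_pow_badCountOn]
  refine (tsum_indepLaw_mul_prod K p fun j a => if j ∈ T then (if a ∈ D j then (2 : ℝ≥0∞) else 1) else 1).le.trans ?_
  rw [← Finset.prod_filter_mul_prod_filter_not Finset.univ (· ∈ T), Finset.filter_mem_eq_inter, Finset.univ_inter]
  have h2 : ∏ j ∈ Finset.univ.filter (fun j => ¬ j ∈ T), ∑' a, p j a * (if j ∈ T then (if a ∈ D j then (2 : ℝ≥0∞) else 1) else 1) = 1 :=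
    Finset.prod_eq_one fun j hj => by
      rw [Finset.mem_filter] at hj
      simp only [hj.2, if_false, mul_one, PMF.tsum_coe]
  rw [h2, mul_one]
  refine Finset.prod_le_prod' fun j hj => ?_
  simp only [hj, if_true]
  rw [tsum_mul_ite_two_one]
  exact add_le_add le_rfl (hf j hj)

end Finset

/-! ### Averaging over a prefix of the coins -/

section Coins

/-- **A function of the first `L` coins averages the same over `L + r` coins as over `L` coins.**
[folklore] -/
theorem sum_qreg_take_eq {M : Type*} [AddCommMonoid M] (L r : ℕ) (g : List Bool → M) :
    ∑ c : Fin (L + r) → Bool, g ((List.ofFn c).take L) = 2 ^ r • ∑ c : Fin L → Bool, g (List.ofFn c) := by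
  classical
  rw [← Fintype.sum_equiv (Fin.appendEquiv L r) (fun p => g (List.ofFn p.1)) (fun c => g ((List.ofFn c).take L))
    (fun p => by simp [Fin.appendEquiv, List.ofFn_fin_append]),
    Fintype.sum_prod_type, Finset.sum_comm]
  simp only [Finset.sum_const, Finset.card_univ, Fintype.card_fun, Fintype.card_bool, Fintype.card_fin, Finset.smul_sum]

open AmpBricks

/-- A chunk inside the first `K n` bits is a chunk of the prefix. [folklore] -/
theorem chunk_take {K n : ℕ} (r : List Bool) {i : ℕ} (hi : i < n) : chunk K (r.take (K * n)) i = chunk K r i := by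
  unfold chunk
  rw [List.drop_take, List.take_take, min_eq_left]
  have : K * (i + 1) ≤ K * n := Nat.mul_le_mul_left K hi
  rw [Nat.mul_succ] at this
  omega

/-- **The shift reads only the first `n · Kw` coins.** [folklore] -/
theorem shiftOfCoins_take (n q : ℕ) (r : List Bool) : shiftOfCoins n q (r.take (Kw n q * n)) = shiftOfCoins n q r := by
  funext i
  simp only [shiftOfCoins, chunkVal, chunk_take r i.isLt]

/-- **The shift read off uniform coins is near-uniform** (one-sided): for a `[0,1]`-valued `F`,
`2^{-C} Σ_{c ∈ {0,1}^C} F (shiftOfCoins n q c) ≤ q^{-n} Σ_t F t + n q / 2^{Kw}`, `C = Kw · n`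
(`CoinChunks.sum_chunkVal_div_le` with `n` positions of width `Kw`).
[cite: NaorReingold2004, Construction 4.1; Regev2009 §4 Lemma 4.1 (proof: uniform t)] -/
theorem avg_shiftOfCoins_le {n q : ℕ} [NeZero q] (F : (Fin n → ZMod q) → ℝ) (hF0 : ∀ t, 0 ≤ F t) (hF1 : ∀ t, F t ≤ 1) :
    (∑ c : Fin (Kw n q * n) → Bool, F (shiftOfCoins n q (List.ofFn c))) / 2 ^ (Kw n q * n) ≤
      (∑ t : Fin n → ZMod q, F t) / q ^ n + n * q / 2 ^ Kw n q := by
  have h := sum_chunkVal_div_le (Pos := Fin n) (K := Kw n q) (L := n) (C := Kw n q * n) (Equiv.refl _) le_rfl F hF0 hF1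
  rw [Fintype.card_fin] at h
  refine le_trans (le_of_eq ?_) h
  congr 1
  refine Fintype.sum_equiv (Equiv.vectorEquivFin Bool (Kw n q * n)).symm _ _ fun c => ?_
  congr 1
  funext i
  simp only [shiftOfCoins, Equiv.refl_apply]
  congr 1
  simp [Equiv.vectorEquivFin]

/-- `q < 2^{|bin q|}`. [folklore] -/
theorem lt_two_pow_length_encodeNat (q : ℕ) : q < 2 ^ (encodeNat q).length := by
  rw [Complexity.TM2Pass.length_encodeNat_eq_size]
  exact Nat.lt_size_self q

/-- **The width `Kw = n + |bin q|` makes the error `n q / 2^{Kw} ≤ n / 2ⁿ`.** [folklore] -/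
theorem mul_div_two_pow_Kw_le (n q : ℕ) : (n : ℝ) * q / 2 ^ Kw n q ≤ n / 2 ^ n := by
  have hq : (q : ℝ) ≤ 2 ^ (encodeNat q).length := by exact_mod_cast (lt_two_pow_length_encodeNat q).le
  rw [Kw, pow_add, ← div_mul_div_comm]
  exact mul_le_of_le_one_right (by positivity) ((div_le_one (by positivity)).2 hq)

end Coins

/-! ### Regev's random self-reduction in the secret -/

section Shift

variable {n q : ℕ} [NeZero q]

/-- **Random self-reduction in the secret** (proof of Lemma 4.1): the probability that a solver `A`,
run on the `m` samples of `A_{s,χ}` shifted by `t`, outputs `s + t`, is the success probability of `A`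
against the secret `s + t` on genuine samples of `A_{s+t,χ}`. [cite: Regev2009, §4 Lemma 4.1 (proof)] -/
theorem searchSuccessProbOf_shift (χ : PMF (ZMod q)) (m : ℕ) (A : Solver (Fin n) (ZMod q) m) (s t : Fin n → ZMod q) :
    ((lweSamples χ s m).bind fun S => A (shiftSample t ∘ S)) (s + t) = searchSuccessProbOf χ m A (s + t) := by
  rw [searchSuccessProbOf, ← lweSamples_map_shift χ s t m, PMF.bind_map]
  rfl

/-- **Averaging over a uniform shift gives the average-case success probability**:
`q^{-n} Σ_t Pr[A succeeds against s + t] = searchSuccessProb`. [cite: Regev2009, §4 Lemma 4.1 (proof)] -/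
theorem avg_searchSuccessProbOf_add (χ : PMF (ZMod q)) (m : ℕ) (A : Solver (Fin n) (ZMod q) m) (s : Fin n → ZMod q) :
    ∑ t : Fin n → ZMod q, PMF.uniformOfFintype (Fin n → ZMod q) t * searchSuccessProbOf χ m A (s + t) =
      searchSuccessProb χ m A := by
  rw [searchSuccessProb]
  simp only [PMF.uniformOfFintype_apply]
  exact Fintype.sum_equiv (Equiv.addLeft s) _ _ fun t => rfl

end Shift

end LWE

end Literature.Computability.Cryptography
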